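import Mathlib
import Summits.NavierStokesRegularity.NavierStokesRegularity.Theses.RossbyDichotomy
import Literature.Analysis.FluidPDE.VorticityEquation
import HarnessLib

/-!
# Route RossbyDichotomy — support item `VorticityEquation` PROVED (stmt-NavierStokesRegularity-3579)

The vorticity equation `∂ₜω + (u·∇)ω = (ω·∇)u + νΔω` of a classical solution of unforced
Navier–Stokes on `ℝ³ × [0, T)` (one-sided time derivative within `[0, T)`), `ω = curl u`: the named
fact the route file asked for is now PROVED in the tree
(`IsClassicalNSSolutionOn.isVorticitySolutionOn_Ico`, `Literature/Analysis/FluidPDE/VorticityEquation.lean`;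
Majda–Bertozzi 2002, Prop. 2.4 / (2.110)); the item is its field `vorticity_eq`, by name.

HONEST FRAMING: bookkeeping; nothing here bears on the regularity question. Lands
`--workitem stmt-NavierStokesRegularity-3579` (typer seat g19 of cell pub-ns-dss, idle-row item).
-/

namespace Summit.NavierStokesRegularity.NavierStokesRegularity.Theorems

set_option linter.dupNamespace false

open Literature.Analysis.FluidPDE

/-- **`VorticityEquation` (stmt-NavierStokesRegularity-3579)**: the vorticity formulation of a
classical unforced solution on `[0, T)` (`isVorticitySolutionOn_Ico`, field `vorticity_eq`;
`vorticity u = fun s => curl (u s)` definitionally). [this file] -/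
theorem rossbyDichotomy_vorticityEquation_proof : Theses.RossbyDichotomy.VorticityEquation := by
  intro ν T hν hT u p hsol t ht x
  exact (hsol.isVorticitySolutionOn_Ico (fun _ _ y => curl_zero y)).vorticity_eq t ht x

end Summit.NavierStokesRegularity.NavierStokesRegularity.Theorems
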